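import Literature.Computability.Complexity.GraphRelabelBricks
import Literature.Computability.Complexity.LexCompareBricks
import HarnessLib

/-!
# Leader fold brick: the lexicographic leader over a listed set of labelings is in `FP`

Toolkit (brick algebra; `FoldBricks.lean`: the generic fold `foldLoop op f p`), the last
canoniser-independent stage of the discharge programme of `babaiLuks1983_canonicalForm`
(`GraphCanonizationLeader.lean`, `GraphCanonizationProofs.lean`): given the code of a coloured
graph and a LIST of labelings `encList [permCode e₀, …, permCode e_{m-1}]` (`m ≥ 1`), fold the
minimum brick `LexCmp.lexMinFn` over the relabelled codes `GraphRelabel.relabelFn ⟨code, permCode eⱼ⟩`.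

* `LeaderFold.leaderOfListFn ∈ FP` (`leaderOfListFn_mem_FP`), and
* **`leaderOfListFn ⟨colGraphCode k G col, encList (L.map permCode)⟩ = leaderCode S _ G col`**
  whenever the nonempty list `L` enumerates the finite set `S` (`leaderOfListFn_apply`).

So a canonical-labeling algorithm discharges the named fact (through
`babaiLuks1983_canonicalForm_of_leader`) as soon as an `FP` brick lists, on the padded code, its
(equivariant, nonempty) labeling set — the only algorithm-specific machine left to build.

Pieces past the end of the list re-read item `0` (the test `isNilFn ∘ dropItemsFn`), so the fold may
safely run `|E|` rounds; pieces are clipped to `|x|` symbols for the growth bookkeeping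
(`pclipF X`, unclipped by `foldAcc_pclipF` since a relabelled code is as long as the code).

## References

* S. Arora, B. Barak, *Computational Complexity: A Modern Approach*, CUP 2009, §1.3 (bounded loops).
* L. Babai, E. M. Luks, *Canonical labeling of graphs*, STOC 1983, §1 (canonical form =
  lexicographic leader over the canonical labelings). [BabaiLuks1983]
-/

namespace Literature.Computability.Complexity

open _root_.Computability Polynomial Brick Plumb HashBricks GraphRelabel LexCmp

namespace LeaderFold

/-! ### `lexLeFn` / `lexMinFn` on every input -/

/-- The comparison brick reads its argument through the pair projections, on every input. [folklore] -/
theorem lexLeFn_apply (w : List Bool) : lexLeFn w = [decide (fstF w ≤ sndF w)] := by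
  obtain ⟨u', v', h⟩ := iterate_lexStep (fstF w) (sndF w) (fstF w) ((fstF w).length + 1) le_rfl
  have hinit : lexInit w = rec4 (fstF w) (fstF w) (sndF w) [] := by simp [lexInit, rec4, fstF, sndF]
  simp only [lexLeFn, Function.comp_apply, hinit, boolUnpair_rec4_fst, eval_add, eval_X, eval_one]
  rw [h, sndPow_two_rec4, lexLeB_eq]

/-- `lexMinFn w` is one of the two projections, on every input. [folklore] -/
theorem lexMinFn_apply (w : List Bool) : lexMinFn w = if fstF w ≤ sndF w then fstF w else sndF w := by
  rw [lexMinFn, iteFn_apply (lexLeFn_apply w)]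
  by_cases h : fstF w ≤ sndF w <;> simp [h]

/-- **Growth of the minimum brick**: `|lexMinFn w| ≤ |fstF w| + |sndF w|`. [folklore] -/
theorem length_lexMinFn_le (w : List Bool) : (lexMinFn w).length ≤ (fstF w).length + (sndF w).length + 0 := by
  rw [lexMinFn_apply]; split_ifs <;> omega

/-! ### Folding `min` -/

/-- The fold of `lexMinFn` is the left fold of `min` over the pieces. [folklore] -/
theorem foldAcc_lexMinFn (f : List Bool → List Bool) (x : List Bool) : ∀ (n : ℕ) (acc : List Bool),
    foldAcc lexMinFn f x 0 n acc = ((List.range n).map fun j => f (boolPair x (ones j))).foldl min acc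
  | 0, acc => rfl
  | n + 1, acc => by
    rw [foldAcc_succ', foldAcc_lexMinFn f x n acc, lexMinFn_boolPair, List.range_succ, List.map_append,
      List.foldl_append, List.map_singleton, List.foldl_cons, List.foldl_nil, Nat.zero_add]

/-- A left fold of `min` is a member of the folded values (or the start). [folklore] -/
theorem foldl_min_mem (l : List (List Bool)) : ∀ a : List Bool, l.foldl min a ∈ a :: l := by
  induction l with
  | nil => intro a; simp
  | cons b l ih =>
    intro a
    rw [List.foldl_cons]
    have h := ih (min a b)
    rcases List.mem_cons.1 h with h | h
    · rw [h]; rcases min_choice a b with h' | h' <;> simp [h']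
    · exact List.mem_cons_of_mem _ (List.mem_cons_of_mem _ h)

/-- A left fold of `min` is below the start and every folded value. [folklore] -/
theorem foldl_min_le (l : List (List Bool)) : ∀ (a c : List Bool), c ∈ a :: l → l.foldl min a ≤ c := by
  induction l with
  | nil => intro a c hc; simp at hc; simp [hc]
  | cons b l ih =>
    intro a c hc
    rw [List.foldl_cons]
    rcases List.mem_cons.1 hc with rfl | hc
    · exact (ih _ _ (List.mem_cons_self ..)).trans (min_le_left _ _)
    rcases List.mem_cons.1 hc with rfl | hc
    · exact (ih _ _ (List.mem_cons_self ..)).trans (min_le_right _ _)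
    · exact ih _ _ (List.mem_cons_of_mem _ hc)

/-- **A left fold of `min` computes `Finset.min'`**: if the start and the folded values all lie in a
finite set `T` and every member of `T` occurs among them, the fold is `T.min'`. [folklore] -/
theorem foldl_min_eq_min' {l : List (List Bool)} {a : List Bool} {T : Finset (List Bool)} (hT : T.Nonempty)
    (h₁ : ∀ c ∈ a :: l, c ∈ T) (h₂ : ∀ c ∈ T, c ∈ a :: l) : l.foldl min a = T.min' hT :=
  le_antisymm (Finset.le_min' _ _ _ fun c hc => foldl_min_le l a c (h₂ c hc))
    (Finset.min'_le _ _ (h₁ _ (foldl_min_mem l a)))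

/-! ### The piece: the relabelled code along item `j` (item `0` past the end) -/

/-- The selected item of a piece record `⟨⟨code, E⟩, 1ʲ⟩`: `E[j]`, or `E[0]` when `j` is past the
end (`sndF^j E = ε`). [folklore] -/
noncomputable def selF : List Bool → List Bool :=
  iteFn (isNilFn ∘ dropItemsFn ∘ fanoutFn sndF (sndF ∘ fstF))
    (nthItemFn ∘ fanoutFn (fun _ => []) (sndF ∘ fstF)) (nthItemFn ∘ fanoutFn sndF (sndF ∘ fstF))

/-- `selF ∈ FP`. [folklore] -/
theorem selF_mem_FP : selF ∈ FP :=
  iteFn_mem_FP (comp_mem_FP isNilFn_mem_FP (comp_mem_FP dropItemsFn_mem_FP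
      (fanoutFn_mem_FP sndF_mem_FP (comp_mem_FP sndF_mem_FP fstF_mem_FP))))
    (comp_mem_FP nthItemFn_mem_FP (fanoutFn_mem_FP (const_mem_FP _) (comp_mem_FP sndF_mem_FP fstF_mem_FP)))
    (comp_mem_FP nthItemFn_mem_FP (fanoutFn_mem_FP sndF_mem_FP (comp_mem_FP sndF_mem_FP fstF_mem_FP)))

/-- Value of `selF` within the list. [folklore] -/
theorem selF_rec_lt (c : List Bool) (P : List (List Bool)) {j : ℕ} (hj : j < P.length) :
    selF (boolPair (boolPair c (encList P)) (ones j)) = P.getD j [] := by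
  rw [selF, iteFn_apply_false]
  · simp [nthItemFn_ones_encList]
  · simp [sndF_iterate_encList, isNilFn, encList_eq_nil_iff, List.drop_eq_nil_iff, Nat.not_le.2 hj]

/-- Value of `selF` past the end of the list. [folklore] -/
theorem selF_rec_ge (c : List Bool) (P : List (List Bool)) {j : ℕ} (hj : P.length ≤ j) :
    selF (boolPair (boolPair c (encList P)) (ones j)) = P.getD 0 [] := by
  rw [selF, iteFn_apply_true]
  · have := nthItemFn_ones_encList 0 P
    simpa using this
  · simp [sndF_iterate_encList, isNilFn, encList_eq_nil_iff, List.drop_eq_nil_iff, hj]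

/-- **The piece**: the relabel brick on `⟨code, selected item⟩`. [folklore] -/
noncomputable def pieceF : List Bool → List Bool := relabelFn ∘ fanoutFn (fstF ∘ fstF) selF

/-- `pieceF ∈ FP`. [folklore] -/
theorem pieceF_mem_FP : pieceF ∈ FP :=
  comp_mem_FP relabelFn_mem_FP (fanoutFn_mem_FP (comp_mem_FP fstF_mem_FP fstF_mem_FP) selF_mem_FP)

/-- Value of the piece on the code of a coloured graph and a list of permutation codes. [folklore] -/
theorem pieceF_rec {k : ℕ} (G : SimpleGraph (Fin k)) (col : Fin k → ℕ) (L : List (Equiv.Perm (Fin k)))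
    (hL : L ≠ []) (j : ℕ) :
    ∃ e ∈ L, pieceF (boolPair (boolPair (colGraphCode k G col) (encList (L.map permCode))) (ones j)) =
      relabelCode k G col e := by
  rcases Nat.lt_or_ge j L.length with hj | hj
  · refine ⟨L[j], List.getElem_mem hj, ?_⟩
    rw [pieceF, Function.comp_apply, fanoutFn_apply, Function.comp_apply, fstF_boolPair, fstF_boolPair,
      selF_rec_lt _ _ (by simpa using hj), List.getD_eq_getElem?_getD, List.getElem?_map,
      List.getElem?_eq_getElem hj]
    exact relabelFn_apply G col _
  · obtain ⟨e, L', rfl⟩ := List.exists_cons_of_ne_nil hL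
    refine ⟨e, List.mem_cons_self .., ?_⟩
    rw [pieceF, Function.comp_apply, fanoutFn_apply, Function.comp_apply, fstF_boolPair, fstF_boolPair,
      selF_rec_ge _ _ (by simpa using hj)]
    exact relabelFn_apply G col e

/-! ### Relabelled codes are as long as the code -/

/-- The length of the code of a coloured graph: a symmetric function of the colours. [folklore] -/
theorem length_colGraphCode (k : ℕ) (G : SimpleGraph (Fin k)) (col : Fin k → ℕ) :
    (colGraphCode k G col).length =
      2 * (2 * (encodeNat k).length + 2 + k * k) + 2 + (2 * k + 2 + ∑ i : Fin k, (2 * (encodeNat (col i)).length + 2)) := by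
  simp only [colGraphCode, length_boolPair, encodingGraph_encode, GraphSwap.length_encode, encode_colours,
    List.length_replicate, length_encList, List.map_ofFn, List.sum_ofFn, Function.comp_apply]

/-- **A relabelled code has the length of the code.** [folklore] -/
theorem length_relabelCode {k : ℕ} (G : SimpleGraph (Fin k)) (col : Fin k → ℕ) (e : Equiv.Perm (Fin k)) :
    (relabelCode k G col e).length = (colGraphCode k G col).length := by
  rw [relabelCode, length_colGraphCode, length_colGraphCode]
  congr 2
  exact Equiv.sum_comp e (fun i => 2 * (encodeNat (col i)).length + 2)

/-! ### The brick -/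

/-- The start value `relabelFn ⟨code, E[0]⟩` from `z = ⟨code, E⟩`. [folklore] -/
noncomputable def startF : List Bool → List Bool :=
  relabelFn ∘ fanoutFn fstF (nthItemFn ∘ fanoutFn (fun _ => []) sndF)

/-- `startF ∈ FP`. [folklore] -/
theorem startF_mem_FP : startF ∈ FP :=
  comp_mem_FP relabelFn_mem_FP (fanoutFn_mem_FP fstF_mem_FP
    (comp_mem_FP nthItemFn_mem_FP (fanoutFn_mem_FP (const_mem_FP _) sndF_mem_FP)))

/-- `startF` on a pair. [folklore] -/
theorem startF_boolPair (c : List Bool) (P : List (List Bool)) :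
    startF (boolPair c (encList P)) = relabelFn (boolPair c (P.getD 0 [])) := by
  have h0 : nthItemFn (boolPair [] (encList P)) = P.getD 0 [] := nthItemFn_ones_encList 0 P
  rw [startF, Function.comp_apply, fanoutFn_apply, fstF_boolPair, Function.comp_apply, fanoutFn_apply,
    sndF_boolPair, h0]

/-- The initial fold record `⟨z, ⟨⟨|E|⟩₂, ⟨1⁰, startF z⟩⟩⟩` from `z = ⟨code, E⟩`. [folklore] -/
noncomputable def leaderInit : List Bool → List Bool :=
  fanoutFn (fun z => z) (fanoutFn (lenBinF ∘ sndF) (fanoutFn (fun _ => []) startF))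

/-- `leaderInit ∈ FP`. [folklore] -/
theorem leaderInit_mem_FP : leaderInit ∈ FP :=
  fanoutFn_mem_FP OracleCompose.id_mem_FP (fanoutFn_mem_FP (comp_mem_FP lenBinF_mem_FP sndF_mem_FP)
    (fanoutFn_mem_FP (const_mem_FP _) startF_mem_FP))

/-- `leaderInit` on a pair. [folklore] -/
theorem leaderInit_boolPair (c : List Bool) (P : List (List Bool)) :
    leaderInit (boolPair c (encList P)) =
      boolPair (boolPair c (encList P)) (boolPair (encodeNat (encList P).length)
        (boolPair [] (relabelFn (boolPair c (P.getD 0 []))))) := by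
  rw [leaderInit, fanoutFn_apply, fanoutFn_apply, fanoutFn_apply, Function.comp_apply, sndF_boolPair,
    lenBinF_apply, startF_boolPair]

/-- **The leader-of-a-list brick**: `|E|` rounds of the `min`-fold of the (clipped) pieces. [cite: AroraBarak2009, §1.3 (bounded loops)] -/
noncomputable def leaderOfListFn : List Bool → List Bool :=
  sndPow 2 ∘ foldLoop lexMinFn (pclipF X pieceF) X ∘ leaderInit

/-- **`leaderOfListFn ∈ FP`.** [cite: AroraBarak2009, §1.3 (bounded loops)] -/
theorem leaderOfListFn_mem_FP : leaderOfListFn ∈ FP :=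
  comp_mem_FP (sndPow_mem_FP 2)
    (comp_mem_FP (foldLoop_pclipF_mem_FP X lexMinFn_mem_FP length_lexMinFn_le pieceF_mem_FP X) leaderInit_mem_FP)

/-- **Semantics of the leader-of-a-list brick**: on the code of a coloured graph and the codes of a
nonempty list `L` of labelings enumerating the finite set `S`, it returns the lexicographic leader
`leaderCode S _ G col` (`GraphCanonizationLeader.lean`). [cite: BabaiLuks1983, §1 (lexicographic leader)] -/
theorem leaderOfListFn_apply {k : ℕ} (G : SimpleGraph (Fin k)) (col : Fin k → ℕ)
    (L : List (Equiv.Perm (Fin k))) (S : Finset (Equiv.Perm (Fin k))) (hS : S.Nonempty)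
    (hLS : ∀ e, e ∈ S ↔ e ∈ L) :
    leaderOfListFn (boolPair (colGraphCode k G col) (encList (L.map permCode))) = leaderCode S hS G col := by
  have hL : L ≠ [] := by
    obtain ⟨e, he⟩ := hS
    exact List.ne_nil_of_mem ((hLS e).1 he)
  obtain ⟨e₀, L', hL'⟩ := List.exists_cons_of_ne_nil hL
  have hpiece : ∀ j, ∃ e ∈ L, pieceF (boolPair (boolPair (colGraphCode k G col) (encList (L.map permCode)))
      (ones j)) = relabelCode k G col e := fun j => pieceF_rec G col L hL j
  have hstart : relabelFn (boolPair (colGraphCode k G col) ((L.map permCode).getD 0 [])) =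
      relabelCode k G col e₀ := by
    rw [hL']; exact relabelFn_apply G col e₀
  have h2 : 2 * L.length ≤ (encList (L.map permCode)).length := by
    rw [length_encList, List.map_map]
    clear hL hL' hpiece hstart hLS
    induction L with
    | nil => simp
    | cons a L ih => simp only [List.map_cons, List.sum_cons, List.length_cons, Function.comp_apply]; omega
  -- the run of the fold loop (`|E|` rounds available since `|E| ≤ |x|`)
  have hrun := foldLoop_apply lexMinFn (pclipF X pieceF) (p := X)
    (x := boolPair (colGraphCode k G col) (encList (L.map permCode))) (k := (encList (L.map permCode)).length)
    (by simp [length_boolPair]) 0 (relabelFn (boolPair (colGraphCode k G col) ((L.map permCode).getD 0 [])))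
  simp only [ones, List.replicate_zero, Nat.zero_add] at hrun
  rw [leaderOfListFn, Function.comp_apply, Function.comp_apply, leaderInit_boolPair, hrun]
  simp only [sndPow_succ_boolPair, sndPow_zero_boolPair]
  -- every piece actually folded is a relabelled code, hence short: unclip; then the fold is `foldl min`
  rw [foldAcc_pclipF (fun j _ _ => by
      obtain ⟨e, -, he⟩ := hpiece j
      rw [he, eval_X, length_relabelCode, length_boolPair]; omega),
    foldAcc_lexMinFn, hstart, leaderCode]
  refine foldl_min_eq_min' _ (fun d hd => ?_) (fun d hd => ?_)
  · -- folded values are codes along members of `S`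
    rcases List.mem_cons.1 hd with rfl | hd
    · exact Finset.mem_image_of_mem _ ((hLS e₀).2 (hL' ▸ List.mem_cons_self ..))
    · obtain ⟨j, -, rfl⟩ := List.mem_map.1 hd
      obtain ⟨e, he, hje⟩ := hpiece j
      rw [hje]
      exact Finset.mem_image_of_mem _ ((hLS e).2 he)
  · -- every code along a member of `S` is folded: the round `j` for the position `j` of `e` in `L`
    obtain ⟨e, he, rfl⟩ := Finset.mem_image.1 hd
    obtain ⟨j, hj, rfl⟩ := List.getElem_of_mem ((hLS e).1 he)
    refine List.mem_cons_of_mem _ (List.mem_map.2 ⟨j, List.mem_range.2 (by omega), ?_⟩)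
    rw [pieceF, Function.comp_apply, fanoutFn_apply, Function.comp_apply, fstF_boolPair, fstF_boolPair,
      selF_rec_lt _ _ (by simpa using hj), List.getD_eq_getElem?_getD, List.getElem?_map,
      List.getElem?_eq_getElem hj]
    exact relabelFn_apply G col _

end LeaderFold

end Literature.Computability.Complexity
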